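import Summits.CriticalPhenomena.PercolationContinuityZ3.Theorems.SahiMasterFamilyPhiOrbitSevenR
import Summits.CriticalPhenomena.PercolationContinuityZ3.Theorems.SahiMasterFamilyPhiOrbitSevenD1
import Summits.CriticalPhenomena.PercolationContinuityZ3.Theorems.SahiMasterFamilyPhiOrbitSevenD2
import Summits.CriticalPhenomena.PercolationContinuityZ3.Theorems.SahiMasterFamilyPrincipalCapLeSix

/-!
# `F(7)` holds — Sahi's `C₇` on the principal-cap stratum, as a KERNEL theorem (standard axioms)

Unit `prim-masterthm-p4` (gen 13; crux anchor stmt-CriticalPhenomena-4575, helper work; memo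
`run/shared/lean/prim/prim-masterthm/prim-masterthm-p4/P4-GEN13-REPORT.md` §9).  Assembly of the orbit-basis check (`…PhiOrbit`,
`…PhiOrbitSevenR/D1/D2`) through `PhiCert.phiNonneg_of_orbitPieces'`: the exact certificate of kit j124604
(`Φ₇ = (1/5040) Σ_{g∈S₇} Σ_{t≤50} c_t g·∏atoms_t`, verified twice outside Lean and, symmetrised SYMBOLICALLY, here by the kernel).
* `phiNonneg_seven : PhiNonneg 7` — **`F(7)`**: `Φ₇(β) ≥ 0` for every `β : Finset (Fin 7) → [0,1]` with `β univ = 1`, `β_S β_T ≤ β_{S∪T}`.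
* `phiNonneg_of_le_seven` — `F(n)` for every `n ≤ 7` (with `…PrincipalCapLeSix`).
* **`sahiE_seven_ind_nonneg_of_principalCap`**, **`sahiE_ind_nonneg_of_principalCap_of_le_seven`** — for every finite product of two-point spaces,
  every `p ∈ [0,1]^ι`, every `n ≤ 7` and every `n` increasing events whose common part is a principal up-set, `E_n(μ_p; 1_U) ≥ 0`:
  **Sahi's `C_n` on the principal-cap stratum for all `n ≤ 7`.**
HONEST FRAMING: `C_n` / Kahn's Conjecture 5 / the master theorem remain OPEN in general; `F(8)` open (certificate search kit j127497 running at the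
time of writing).  Axioms standard (the compiled-evaluation variant `…PhiCertSeven` is superseded by this file). [this work]
-/

set_option autoImplicit false

namespace Summit.CriticalPhenomena.PercolationContinuityZ3.Theorems

namespace PhiCert

open Literature.Combinatorics.Sahi2008
open Literature.Probability.Percolation.DecisionTree (ind)

/-- **`F(7)`** (`PhiNonneg 7`), kernel theorem via the orbit-basis certificate check. [compute j124604] [this work] -/
theorem phiNonneg_seven : PrincipalCapBeta.PhiNonneg 7 :=
  phiNonneg_of_orbitPieces' 6 2 (by norm_num) _ _ _ (by decide) dataD_seven normR_seven reconD_seven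

/-- **`F(n)` for every `n ≤ 7`.** [this work] -/
theorem phiNonneg_of_le_seven {n : ℕ} (hn : n ≤ 7) : PrincipalCapBeta.PhiNonneg n := by
  rcases Nat.lt_or_ge n 7 with h | h
  · exact PrincipalCapBeta.phiNonneg_of_le_six (by omega)
  · have h7 : n = 7 := by omega
    subst h7
    exact phiNonneg_seven

/-- **Sahi's `C₇` on the principal-cap stratum**: for every finite product of two-point spaces, every `p ∈ [0,1]^ι` and every seven increasing
events whose common part is a principal up-set, `E₇(μ_p; 1_{U_0},…,1_{U_6}) ≥ 0`. [this work] -/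
theorem sahiE_seven_ind_nonneg_of_principalCap {ι : Type} [Fintype ι] (p : ι → unitInterval) (U : Fin 7 → Set (Set ι))
    (hU : ∀ j, IsUpperSet (U j)) (c : Finset ι) (hpc : ∀ T : Set ι, (∀ j, T ∈ U j) ↔ (↑c : Set ι) ⊆ T) :
    0 ≤ sahiE (bernoulliWeight p) 7 (fun j => ind (U j)) :=
  PrincipalCapBeta.sahiE_ind_nonneg_of_phiNonneg phiNonneg_seven p U hU c hpc

/-- **Sahi's `C_n` on the principal-cap stratum for every `n ≤ 7`.** [this work] -/
theorem sahiE_ind_nonneg_of_principalCap_of_le_seven {ι : Type} [Fintype ι] {k : ℕ} (hk : k + 1 ≤ 7) (p : ι → unitInterval)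
    (U : Fin (k + 1) → Set (Set ι)) (hU : ∀ j, IsUpperSet (U j)) (c : Finset ι)
    (hpc : ∀ T : Set ι, (∀ j, T ∈ U j) ↔ (↑c : Set ι) ⊆ T) :
    0 ≤ sahiE (bernoulliWeight p) (k + 1) (fun j => ind (U j)) :=
  PrincipalCapBeta.sahiE_ind_nonneg_of_phiNonneg (phiNonneg_of_le_seven hk) p U hU c hpc

/-- `MasterFamilyNonneg` vocabulary: the master inequality of every order `≤ 7` on the principal-cap stratum. [this work] -/
theorem masterFamily_nonneg_of_principalCap_of_le_seven {k : ℕ} (hk : k + 1 ≤ 7) (ι : Type) [Fintype ι] (p : ι → unitInterval)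
    (U : Fin (k + 1) → Set (Set ι)) (hU : ∀ j, IsUpperSet (U j)) (c : Finset ι)
    (hpc : ∀ T : Set ι, (∀ j, T ∈ U j) ↔ (↑c : Set ι) ⊆ T) :
    0 ≤ sahiE (bernoulliWeight p) (k + 1) (fun j => ind (U j)) :=
  sahiE_ind_nonneg_of_principalCap_of_le_seven hk p U hU c hpc

end PhiCert

end Summit.CriticalPhenomena.PercolationContinuityZ3.Theorems
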